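import Literature.RingTheory.Flat.AmitsurDegreeOne
import HarnessLib

/-!
# Amitsur in degree one, KERNEL-PAIR spelling: cocycles in `(S ⊗ S) ⊗ N` for the three algebra cofaces `S ⊗ S → S ⊗ (S ⊗ S)`,
# and the transport `P ⊗_R J ≅ J·P` for an ideal `J ⊆ R` and a flat `R`-algebra `P`

Topic `Literature/RingTheory/Flat`, namespace `Literature.RingTheory.Flat`.  THEOREMS ONLY; no definition, no named fact, no instance, no
notation, no `sorry`.  ED.-2-style DRESS of ★ `AmitsurDegreeOne` (same namespace) in the currency a RING-side consumer has: the two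
coprojections `includeLeft, includeRight : S ⇉ S ⊗_R S` of the kernel pair `Spec (S ⊗ S) ⇉ Spec S` and the three cofaces
`S ⊗ S → S ⊗ (S ⊗ S)` (`includeRight`, `map id includeRight`, `map id includeLeft`, i.e. `pr₂₃, pr₁₃, pr₁₂`), tensored on the RIGHT with the
coefficient module `N` — exactly as ★ `AmitsurDegreeZero.mem_range_mk_one_iff_rTensor` dresses degree zero.

* §1 `assoc_assoc_rTensor_coface₀∕₁∕₂` — under `((S ⊗ (S ⊗ S)) ⊗ N ≅ S ⊗ (S ⊗ (S ⊗ N))` the three `rTensor N (coface)` become ★'s `∂₀ = 1 ⊗ –`,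
  `∂₁ = S ⊗ (1 ⊗ –)`, `∂₂ = S ⊗ S ⊗ (1 ⊗ –)`; **`exists_eq_rTensor_includeLeft_sub_includeRight_of_cocycle`** — for `R → S` faithfully flat, every
  `y ∈ (S ⊗ S) ⊗ N` with `(pr₁₂ ⊗ N) y + (pr₂₃ ⊗ N) y = (pr₁₃ ⊗ N) y` is `(includeLeft ⊗ N) x − (includeRight ⊗ N) x` for some `x ∈ S ⊗ N`
  ([StacksProject, Tag 023M]; [GortzWedhorn2020] Lemma 14.65).
* §2 For an `R`-algebra `P` and an ideal `J ⊆ R`, the multiplication map `m_P : P ⊗_R J → P`, `p ⊗ j ↦ j • p` (spelled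
  `rid ∘ lTensor P J.subtype`): `rid_lTensor_subtype_tmul`, **injective when `P` is flat** (`rid_lTensor_subtype_injective`), image INSIDE
  `J·P = J.map (algebraMap R P)` (`rid_lTensor_subtype_mem_map`) and ONTO it (`exists_rid_lTensor_subtype_eq_of_mem_map`), NATURAL in algebra
  maps (`algHom_rid_lTensor_subtype`) — so that «coordinates in the ideal `J·P`» of a flat `P` are elements of `P ⊗_R J`, functorially
  ([StacksProject, Tag 00HI]: `I ⊗_R M → M` injective for flat `M`; [GortzWedhorn2020] Prop. B.16).

Written for cell `hodgecm-mathlib` (P6b σ2, E2a road KF1♭ organ T3∕S8: the Amitsur 1-cocycle of unit-lift coordinates along a finite faithfully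
flat cover); HC_CM is proved only modulo the 7 printed citations until rung 0 closes; nothing here is about HC.

## References
* [StacksProject] The Stacks Project, Tag 023M (Descent, Lemma 35.3.6), Tag 00HI (flatness and `I ⊗ M → M`).
* [GortzWedhorn2020] U. Görtz, T. Wedhorn, *Algebraic Geometry I*, 2nd ed. (2020), Lemma 14.65; Prop. B.16.
-/

universe u v w

open TensorProduct

namespace Literature.RingTheory.Flat

/-! ## §1 The kernel-pair spelling of degree-one exactness -/

section KernelPair

variable (R : Type u) (S : Type v) [CommRing R] [CommRing S] [Algebra R S]
variable (N : Type w) [AddCommGroup N] [Module R N]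

/-- Transport of the coface `pr₂₃ = includeRight : S ⊗ S → S ⊗ (S ⊗ S)` (`z ↦ 1 ⊗ z`), tensored with `N`: under the re-associations it is
★'s `∂₀ = (1 ⊗ –)`. [cite: StacksProject, Tag 023M] -/
theorem assoc_assoc_rTensor_coface₀ (y : (S ⊗[R] S) ⊗[R] N) :
    (TensorProduct.assoc R S S N).lTensor S (TensorProduct.assoc R S (S ⊗[R] S) N
      (LinearMap.rTensor N (Algebra.TensorProduct.includeRight : S ⊗[R] S →ₐ[R] S ⊗[R] (S ⊗[R] S)).toLinearMap y)) =
      TensorProduct.mk R S (S ⊗[R] (S ⊗[R] N)) 1 (TensorProduct.assoc R S S N y) := by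
  induction y using TensorProduct.induction_on with
  | zero => simp
  | tmul z n =>
      induction z using TensorProduct.induction_on with
      | zero => simp
      | tmul s s' => simp
      | add z z' hz hz' => simp only [add_tmul, map_add, hz, hz']
  | add y y' hy hy' => simp only [map_add, hy, hy']

/-- Transport of the coface `pr₁₃ = S ⊗ includeRight : S ⊗ S → S ⊗ (S ⊗ S)` (`s ⊗ s′ ↦ s ⊗ 1 ⊗ s′`), tensored with `N`: under the
re-associations it is ★'s `∂₁ = S ⊗ (1 ⊗ –)`. [cite: StacksProject, Tag 023M] -/
theorem assoc_assoc_rTensor_coface₁ (y : (S ⊗[R] S) ⊗[R] N) :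
    (TensorProduct.assoc R S S N).lTensor S (TensorProduct.assoc R S (S ⊗[R] S) N
      (LinearMap.rTensor N (Algebra.TensorProduct.map (AlgHom.id R S)
        (Algebra.TensorProduct.includeRight : S →ₐ[R] S ⊗[R] S)).toLinearMap y)) =
      LinearMap.lTensor S (TensorProduct.mk R S (S ⊗[R] N) 1) (TensorProduct.assoc R S S N y) := by
  induction y using TensorProduct.induction_on with
  | zero => simp
  | tmul z n =>
      induction z using TensorProduct.induction_on with
      | zero => simp
      | tmul s s' => simp
      | add z z' hz hz' => simp only [add_tmul, map_add, hz, hz']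
  | add y y' hy hy' => simp only [map_add, hy, hy']

/-- Transport of the coface `pr₁₂ = S ⊗ includeLeft : S ⊗ S → S ⊗ (S ⊗ S)` (`s ⊗ s′ ↦ s ⊗ s′ ⊗ 1`), tensored with `N`: under the
re-associations it is ★'s `∂₂ = S ⊗ S ⊗ (1 ⊗ –)`. [cite: StacksProject, Tag 023M] -/
theorem assoc_assoc_rTensor_coface₂ (y : (S ⊗[R] S) ⊗[R] N) :
    (TensorProduct.assoc R S S N).lTensor S (TensorProduct.assoc R S (S ⊗[R] S) N
      (LinearMap.rTensor N (Algebra.TensorProduct.map (AlgHom.id R S)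
        (Algebra.TensorProduct.includeLeft : S →ₐ[R] S ⊗[R] S)).toLinearMap y)) =
      LinearMap.lTensor S (LinearMap.lTensor S (TensorProduct.mk R S N 1)) (TensorProduct.assoc R S S N y) := by
  induction y using TensorProduct.induction_on with
  | zero => simp
  | tmul z n =>
      induction z using TensorProduct.induction_on with
      | zero => simp
      | tmul s s' => simp
      | add z z' hz hz' => simp only [add_tmul, map_add, hz, hz']
  | add y y' hy hy' => simp only [map_add, hy, hy']

variable [Module.FaithfullyFlat R S]

/-- **Amitsur `H¹ = 0`, kernel-pair spelling** ([StacksProject, Tag 023M]; [GortzWedhorn2020] Lemma 14.65): for `R → S` faithfully flat and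
an `R`-module `N`, every `y ∈ (S ⊗_R S) ⊗_R N` satisfying the cocycle identity for the three cofaces `pr₁₂ = S ⊗ includeLeft`,
`pr₂₃ = includeRight`, `pr₁₃ = S ⊗ includeRight` of `S ⊗ S → S ⊗ (S ⊗ S)` — `(pr₁₂ ⊗ N) y + (pr₂₃ ⊗ N) y = (pr₁₃ ⊗ N) y` — is a coboundary:
`y = (includeLeft ⊗ N) x − (includeRight ⊗ N) x` for some `x ∈ S ⊗_R N`.  (★ `exact_coface_one_two` transported along `assoc`.)
[cite: StacksProject, Tag 023M] [cite: GortzWedhorn2020, Lemma 14.65] -/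
theorem exists_eq_rTensor_includeLeft_sub_includeRight_of_cocycle (y : (S ⊗[R] S) ⊗[R] N)
    (hy : LinearMap.rTensor N (Algebra.TensorProduct.map (AlgHom.id R S)
            (Algebra.TensorProduct.includeLeft : S →ₐ[R] S ⊗[R] S)).toLinearMap y +
          LinearMap.rTensor N (Algebra.TensorProduct.includeRight : S ⊗[R] S →ₐ[R] S ⊗[R] (S ⊗[R] S)).toLinearMap y =
        LinearMap.rTensor N (Algebra.TensorProduct.map (AlgHom.id R S)
            (Algebra.TensorProduct.includeRight : S →ₐ[R] S ⊗[R] S)).toLinearMap y) :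
    ∃ x : S ⊗[R] N,
      LinearMap.rTensor N (Algebra.TensorProduct.includeLeft : S →ₐ[R] S ⊗[R] S).toLinearMap x -
        LinearMap.rTensor N (Algebra.TensorProduct.includeRight : S →ₐ[R] S ⊗[R] S).toLinearMap x = y := by
  -- transport the cocycle identity to ★'s spelling
  have hy' : LinearMap.lTensor S (LinearMap.lTensor S (TensorProduct.mk R S N 1)) (TensorProduct.assoc R S S N y) +
        TensorProduct.mk R S (S ⊗[R] (S ⊗[R] N)) 1 (TensorProduct.assoc R S S N y) =
      LinearMap.lTensor S (TensorProduct.mk R S (S ⊗[R] N) 1) (TensorProduct.assoc R S S N y) := by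
    rw [← assoc_assoc_rTensor_coface₂, ← assoc_assoc_rTensor_coface₀, ← assoc_assoc_rTensor_coface₁, ← map_add, ← map_add, hy]
  obtain ⟨x, hx⟩ := exists_eq_coface_one_of_cocycle R S N (TensorProduct.assoc R S S N y) hy'
  refine ⟨x, (TensorProduct.assoc R S S N).injective ?_⟩
  rw [map_sub, assoc_rTensor_includeLeft, assoc_rTensor_includeRight, hx]

end KernelPair

/-! ## §2 The multiplication map `P ⊗_R J → P` onto the ideal `J·P`, injective for flat `P` -/

section IdealTransport

variable {R : Type u} [CommRing R] (J : Ideal R) (P : Type v) [CommRing P] [Algebra R P]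

/-- `m_P (p ⊗ j) = j • p = p · algebraMap j` for the multiplication map `m_P := rid ∘ (P ⊗ J.subtype) : P ⊗_R J → P`.
[cite: StacksProject, Tag 00HI] -/
@[simp]
theorem rid_lTensor_subtype_tmul (p : P) (j : J) :
    ((TensorProduct.rid R P).toLinearMap ∘ₗ LinearMap.lTensor P (Submodule.subtype J)) (p ⊗ₜ[R] j) = (j : R) • p := by
  simp

/-- The multiplication map `P ⊗_R J → P` lands in the extended ideal `J·P = J.map (algebraMap R P)`. [cite: StacksProject, Tag 00HI] -/
theorem rid_lTensor_subtype_mem_map (z : P ⊗[R] J) :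
    ((TensorProduct.rid R P).toLinearMap ∘ₗ LinearMap.lTensor P (Submodule.subtype J)) z ∈ J.map (algebraMap R P) := by
  induction z using TensorProduct.induction_on with
  | zero => rw [map_zero]; exact zero_mem _
  | tmul p j =>
      rw [rid_lTensor_subtype_tmul, Algebra.smul_def, mul_comm]
      exact Ideal.mul_mem_left _ _ (Ideal.mem_map_of_mem _ j.2)
  | add z z' hz hz' => rw [map_add]; exact add_mem hz hz'

/-- The multiplication map `P ⊗_R J → P` is ONTO the extended ideal: every element of `J·P` is `m_P ĉ` for some `ĉ ∈ P ⊗_R J` (the ideal is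
`P`-spanned by the `algebraMap j`, and `p · m_P ĉ = m_P (p·ĉ)`). [cite: StacksProject, Tag 00HI] -/
theorem exists_rid_lTensor_subtype_eq_of_mem_map {c : P} (hc : c ∈ J.map (algebraMap R P)) :
    ∃ z : P ⊗[R] J, ((TensorProduct.rid R P).toLinearMap ∘ₗ LinearMap.lTensor P (Submodule.subtype J)) z = c := by
  -- `m_P` is compatible with multiplication by elements of `P`
  have hmul : ∀ (p : P) (z : P ⊗[R] J), ∃ z' : P ⊗[R] J,
      ((TensorProduct.rid R P).toLinearMap ∘ₗ LinearMap.lTensor P (Submodule.subtype J)) z' =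
        p * ((TensorProduct.rid R P).toLinearMap ∘ₗ LinearMap.lTensor P (Submodule.subtype J)) z := by
    intro p z
    induction z using TensorProduct.induction_on with
    | zero => exact ⟨0, by simp⟩
    | tmul p' j => exact ⟨(p * p') ⊗ₜ j, by simp [Algebra.smul_def, mul_left_comm]⟩
    | add z z' hz hz' =>
        obtain ⟨w, hw⟩ := hz
        obtain ⟨w', hw'⟩ := hz'
        exact ⟨w + w', by rw [map_add, hw, hw', map_add, mul_add]⟩
  rw [Ideal.map] at hc
  induction hc using Submodule.span_induction with
  | mem c hc =>
      obtain ⟨j, hj, rfl⟩ := hc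
      exact ⟨(1 : P) ⊗ₜ ⟨j, hj⟩, by simp [Algebra.smul_def]⟩
  | zero => exact ⟨0, map_zero _⟩
  | add c c' _ _ hc hc' =>
      obtain ⟨z, rfl⟩ := hc
      obtain ⟨z', rfl⟩ := hc'
      exact ⟨z + z', map_add _ _ _⟩
  | smul p c _ hc =>
      obtain ⟨z, rfl⟩ := hc
      obtain ⟨z', hz'⟩ := hmul p z
      exact ⟨z', by rw [hz', smul_eq_mul]⟩

/-- **For a FLAT `R`-algebra `P`, `m_P : P ⊗_R J → P` is injective** (`J ↪ R` stays injective after `P ⊗_R –`; [StacksProject, Tag 00HI]).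
[cite: StacksProject, Tag 00HI] [cite: GortzWedhorn2020, Prop. B.16] -/
theorem rid_lTensor_subtype_injective [Module.Flat R P] :
    Function.Injective ((TensorProduct.rid R P).toLinearMap ∘ₗ LinearMap.lTensor P (Submodule.subtype J)) := by
  rw [LinearMap.coe_comp]
  exact (TensorProduct.rid R P).injective.comp (Module.Flat.lTensor_preserves_injective_linearMap _ J.injective_subtype)

/-- NATURALITY of the multiplication maps in `R`-algebra maps `φ : P → Q`: `φ (m_P z) = m_Q ((φ ⊗ J) z)`. [cite: StacksProject, Tag 00HI] -/
theorem algHom_rid_lTensor_subtype {Q : Type w} [CommRing Q] [Algebra R Q] (φ : P →ₐ[R] Q) (z : P ⊗[R] J) :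
    φ (((TensorProduct.rid R P).toLinearMap ∘ₗ LinearMap.lTensor P (Submodule.subtype J)) z) =
      ((TensorProduct.rid R Q).toLinearMap ∘ₗ LinearMap.lTensor Q (Submodule.subtype J)) (LinearMap.rTensor J φ.toLinearMap z) := by
  induction z using TensorProduct.induction_on with
  | zero => simp
  | tmul p j => simp
  | add z z' hz hz' => simp only [map_add, hz, hz']

end IdealTransport

end Literature.RingTheory.Flat
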